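import Mathlib
import Literature.MathematicalPhysics.QuantumFieldTheory.Balaban1983to89.B8Eq194Criterion

/-!
# [B8] (1.91) vs [4] (3.163)–(3.165): Q′ΔN(Q′) = 0 on product systems, periodic chains and tori
# (cell GAPS G-B8-19 (c), part 2: the «in every d» clause and the complete answer on (ℤ/(LK))^d)

statement-level skeleton of published theorems with citation tags; proofs where landed; nothing here is a claim
about the Yang–Mills mass gap

Seat p40 gen 8, Phase 2, B8 lane; sibling of `B8Eq194Criterion` (read its docstring first: CONTEXT, ERRATUM and
HONEST SCOPE are stated there once for both files).  Kind: located reading note, constants only.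

CONTENT (scalar model 𝔤 = ℝ, flat background; `Crit w m blk` = «Δ = lap w m maps N(Q′) into N(Q′)»):
§1 PRODUCT RULE.  Sites ι → S₀ (ι = the d directions), Kronecker-sum weights `piW w` (z ~ x iff z differs from x
   in one coordinate i, weight w i (x i) (z i)), diagonal term `piM m` = Σ_i m_i(x_i), product blocks `piBlk blk`:
   `coef_pi` — the coefficient vectors split, c_{b′}(x) = Σ_i [∀ j ≠ i, blk_j x_j = b′_j] · c⁽ⁱ⁾_{b′_i}(x_i);
   **`crit_pi_iff`** — the product satisfies the criterion iff EVERY factor does (S₀ ≠ ∅): the «in every d»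
   clause of the by-hand parenthesis, kernel-checked in both directions.
§2 PERIODIC CHAINS ℤ/N, nearest-neighbour weights `cycW N`, K blocks of L consecutive sites `cycBlk L` (N = LK):
   `crit_cyc_one` (L = 1: holds), `crit_cyc_single` (one block: holds), **`not_crit_cyc_three`** (L ≥ 3, K ≥ 2:
   FAILS — the last site of a block has a neighbour in the next block, the second site has none),
   **`not_crit_cyc_two`** (L = 2, K ≥ 3: FAILS), **`crit_cyc_two_two`** ((L, K) = (2, 2), the 4-cycle: HOLDS although
   every site has a bond into the other block — the exception the by-hand clause missed); assembled:
   **`crit_cyc_iff`: Q′ΔN(Q′) = 0 ⟺ L = 1 ∨ K = 1 ∨ (L, K) = (2, 2)** (L, K ≥ 1), and by §1 on the tori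
   (ℤ/(LK))^ι (ι ≠ ∅ finite, cubic blocks of side L) **`crit_torus_iff`** — the same trichotomy in every dimension.
   `not_crit_six`: the instance (L, K) = (3, 2) is the six-site system of `B8Eq194FirstTerm.Witness6`.

HONEST SCOPE.  As in `B8Eq194Criterion`; in addition (v) `cycW N x y` = number of oriented unit steps ±1 (mod N)
from x to y — the simple cycle for N ≥ 3 (every failing case has N ≥ 6; the degenerate N ≤ 2 fall under L = 1 or
one block, which hold for any N); (vi) the torus carries no Dirichlet term (m = 0); ∂Ω₀-bonds are treated only in
`B8Eq194Criterion` (`crit_iff_of_noCross`, `not_crit_dirichlet3`).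

Sources: as in `B8Eq194Criterion` ([Balaban1985RegularSpaces] (1.91) p. 91 [PDF 17]; [Balaban1985BackgroundPropagators]
(3.18)–(3.25) pp. 393–394, (3.162)–(3.165) p. 429 [PDF 5, 6, 41]).
-/

namespace Literature.MathematicalPhysics.QuantumFieldTheory.Balaban1983to89.B8Eq194CriterionTorus

open Finset Literature.MathematicalPhysics.QuantumFieldTheory.Balaban1983to89.B8Eq194Criterion

/-! ## §1  Product systems («in every d»): Kronecker-sum Laplacians with product blocks -/

section Pi

variable {ι S₀ B₀ : Type*} [Fintype ι] [DecidableEq ι] [Fintype S₀] [DecidableEq S₀] [DecidableEq B₀]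

/-- Kronecker-sum weights on `ι → S₀`: z is a neighbour of x iff it differs from x in one coordinate i, with
the factor weight `w i (x i) (z i)`. [cite: Balaban1985BackgroundPropagators, (3.23) p. 394] -/
def piW (w : ι → S₀ → S₀ → ℝ) (x z : ι → S₀) : ℝ :=
  ∑ i, if (∀ j, j ≠ i → z j = x j) then w i (x i) (z i) else 0

/-- Sum of the coordinate Dirichlet terms. [cite: Balaban1985BackgroundPropagators, (3.23) p. 394] -/
def piM (m : ι → S₀ → ℝ) (x : ι → S₀) : ℝ := ∑ i, m i (x i)

/-- Product blocks (cubes = products of intervals). [cite: Balaban1985BackgroundPropagators, (3.18)–(3.19) p. 393] -/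
def piBlk (blk : ι → S₀ → B₀) (x : ι → S₀) : ι → B₀ := fun i => blk i (x i)

/-- helper: a sum over the points agreeing with x off coordinate i is a sum over that coordinate. [folklore] -/
private theorem sum_ite_agree (x : ι → S₀) (i : ι) (g : (ι → S₀) → ℝ) :
    (∑ z : ι → S₀, if (∀ j, j ≠ i → z j = x j) then g z else 0)
      = ∑ s : S₀, g (Function.update x i s) := by
  rw [← Finset.sum_filter]
  have himg : (univ.filter fun z : ι → S₀ => ∀ j, j ≠ i → z j = x j)
      = univ.image (Function.update x i) := by
    ext z
    simp only [mem_filter, mem_univ, true_and, mem_image]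
    refine ⟨fun hz => ⟨z i, funext fun j => ?_⟩, ?_⟩
    · by_cases hj : j = i
      · rw [hj]; exact Function.update_self _ _ _
      · rw [Function.update_of_ne hj]; exact (hz j hj).symm
    · rintro ⟨s, rfl⟩ j hj; exact Function.update_of_ne hj _ _
  rw [himg, Finset.sum_image]
  intro s _ t _ hst
  simpa only [Function.update_self] using congr_fun hst i

/-- helper: degrees add over coordinates. [folklore] -/
private theorem piW_deg (w : ι → S₀ → S₀ → ℝ) (x : ι → S₀) :
    ∑ z, piW w x z = ∑ i, ∑ s, w i (x i) s := by
  unfold piW; rw [Finset.sum_comm]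
  refine Finset.sum_congr rfl fun i _ => ?_
  rw [sum_ite_agree x i (fun z => w i (x i) (z i))]; simp only [Function.update_self]

omit [Fintype ι] [Fintype S₀] [DecidableEq S₀] [DecidableEq B₀] in
/-- helper: block of a point moved in one coordinate. [folklore] -/
private theorem piBlk_update_iff (blk : ι → S₀ → B₀) (x : ι → S₀) (i : ι) (s : S₀) (b' : ι → B₀) :
    piBlk blk (Function.update x i s) = b' ↔ blk i s = b' i ∧ ∀ j, j ≠ i → blk j (x j) = b' j := by
  constructor
  · intro h
    have hj : ∀ j, blk j (Function.update x i s j) = b' j := fun j => congr_fun h j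
    refine ⟨by simpa only [Function.update_self] using hj i, fun j hji => ?_⟩
    simpa only [Function.update_of_ne hji] using hj j
  · rintro ⟨hi, hj⟩
    funext j
    show blk j (Function.update x i s j) = b' j
    by_cases hji : j = i
    · rw [hji, Function.update_self]; exact hi
    · rw [Function.update_of_ne hji]; exact hj j hji

/-- helper: weight from x into a product block, split over coordinates. [folklore] -/
private theorem piW_inBlock (w : ι → S₀ → S₀ → ℝ) (blk : ι → S₀ → B₀) (b' : ι → B₀) (x : ι → S₀) :
    ∑ y ∈ univ with piBlk blk y = b', piW w y x
      = ∑ i, if (∀ j, j ≠ i → blk j (x j) = b' j)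
          then ∑ s ∈ univ with blk i s = b' i, w i s (x i) else 0 := by
  rw [Finset.sum_filter]
  have h1 : ∀ y : ι → S₀, (if piBlk blk y = b' then piW w y x else 0)
      = ∑ i, if (∀ j, j ≠ i → y j = x j) then
          (if piBlk blk y = b' then w i (y i) (x i) else 0) else 0 := by
    intro y
    by_cases hy : piBlk blk y = b'
    · rw [if_pos hy]
      unfold piW
      refine Finset.sum_congr rfl fun i _ => ?_
      rw [if_pos hy]
      have hc : (∀ j, j ≠ i → x j = y j) ↔ (∀ j, j ≠ i → y j = x j) :=
        ⟨fun hh j hj => (hh j hj).symm, fun hh j hj => (hh j hj).symm⟩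
      exact if_congr hc rfl rfl
    · rw [if_neg hy]
      exact (Finset.sum_eq_zero fun i _ => by rw [if_neg hy, ite_self]).symm
  simp_rw [h1]
  rw [Finset.sum_comm]
  refine Finset.sum_congr rfl fun i _ => ?_
  rw [sum_ite_agree x i (fun y => if piBlk blk y = b' then w i (y i) (x i) else 0)]
  simp only [Function.update_self]
  by_cases hC : ∀ j, j ≠ i → blk j (x j) = b' j
  · rw [if_pos hC, Finset.sum_filter]
    refine Finset.sum_congr rfl fun s _ => ?_
    have hc : piBlk blk (Function.update x i s) = b' ↔ blk i s = b' i := by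
      rw [piBlk_update_iff]; exact ⟨fun hh => hh.1, fun hh => ⟨hh, hC⟩⟩
    exact if_congr hc rfl rfl
  · rw [if_neg hC]
    refine Finset.sum_eq_zero fun s _ => if_neg ?_
    rw [piBlk_update_iff]; exact fun hh => hC hh.2

/-- helper: the diagonal part of `coef` for a product system, split over coordinates. [folklore] -/
private theorem piW_indic (w : ι → S₀ → S₀ → ℝ) (m : ι → S₀ → ℝ) (blk : ι → S₀ → B₀) (b' : ι → B₀)
    (x : ι → S₀) :
    (if piBlk blk x = b' then piM m x + ∑ z, piW w x z else 0)
      = ∑ i, if (∀ j, j ≠ i → blk j (x j) = b' j) then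
          (if blk i (x i) = b' i then m i (x i) + ∑ s, w i (x i) s else 0) else 0 := by
  by_cases hx : piBlk blk x = b'
  · have hall : ∀ j, blk j (x j) = b' j := fun j => congr_fun hx j
    rw [if_pos hx, piW_deg]
    unfold piM
    rw [← Finset.sum_add_distrib]
    refine Finset.sum_congr rfl fun i _ => ?_
    rw [if_pos (fun j _ => hall j), if_pos (hall i)]
  · rw [if_neg hx]
    have hex : ∃ j₀, blk j₀ (x j₀) ≠ b' j₀ := by
      by_contra hcon
      exact hx (funext fun j => by by_contra hj; exact hcon ⟨j, hj⟩)
    obtain ⟨j₀, hj₀⟩ := hex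
    refine (Finset.sum_eq_zero fun i _ => ?_).symm
    by_cases hi : i = j₀
    · rw [hi, if_neg hj₀, ite_self]
    · exact if_neg fun hh => hj₀ (hh j₀ (Ne.symm hi))

/-- The coefficient vectors of a product system split over the coordinates.
[cite: Balaban1985BackgroundPropagators, (3.23) and (3.21) p. 394] -/
theorem coef_pi (w : ι → S₀ → S₀ → ℝ) (m : ι → S₀ → ℝ) (blk : ι → S₀ → B₀) (b' : ι → B₀)
    (x : ι → S₀) :
    coef (piW w) (piM m) (piBlk blk) b' x
      = ∑ i, if (∀ j, j ≠ i → blk j (x j) = b' j)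
          then coef (w i) (m i) (blk i) (b' i) (x i) else 0 := by
  unfold coef
  rw [piW_indic, piW_inBlock, ← Finset.sum_sub_distrib]
  refine Finset.sum_congr rfl fun i _ => ?_
  split_ifs <;> simp

/-- **Product rule** («in every d»): the product system satisfies Q′ΔN(Q′) = 0 iff every factor does.
[cite: Balaban1985BackgroundPropagators, (3.163)–(3.165) p. 429; Balaban1985RegularSpaces, (1.91) p. 91] -/
theorem crit_pi_iff [Nonempty S₀] (w : ι → S₀ → S₀ → ℝ) (m : ι → S₀ → ℝ) (blk : ι → S₀ → B₀) :
    Crit (piW w) (piM m) (piBlk blk) ↔ ∀ i, Crit (w i) (m i) (blk i) := by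
  constructor
  · intro h i
    rw [crit_iff] at h ⊢
    intro bi s t hst
    obtain ⟨s₀⟩ := ‹Nonempty S₀›
    let x0 : ι → S₀ := fun _ => s₀
    let b' : ι → B₀ := Function.update (piBlk blk x0) i bi
    have hb'i : b' i = bi := Function.update_self _ _ _
    have hb'j : ∀ j, j ≠ i → b' j = blk j (x0 j) := fun j hj => Function.update_of_ne hj _ _
    have hpi : ∀ j, blk j (Function.update x0 i s j) = blk j (Function.update x0 i t j) := by
      intro j
      by_cases hj : j = i
      · rw [hj, Function.update_self, Function.update_self]; exact hst
      · rw [Function.update_of_ne hj, Function.update_of_ne hj]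
    have key := h b' (Function.update x0 i s) (Function.update x0 i t) (funext hpi)
    rw [coef_pi, coef_pi, ← Finset.add_sum_erase _ _ (mem_univ i),
      ← Finset.add_sum_erase _ _ (mem_univ i)] at key
    have hcond : ∀ u : S₀, (∀ j, j ≠ i → blk j (Function.update x0 i u j) = b' j) := by
      intro u j hj; rw [Function.update_of_ne hj, hb'j j hj]
    rw [if_pos (hcond s), if_pos (hcond t), Function.update_self, Function.update_self, hb'i] at key
    have hrest : ∑ k ∈ univ.erase i, (if (∀ j, j ≠ k → blk j (Function.update x0 i s j) = b' j)
          then coef (w k) (m k) (blk k) (b' k) (Function.update x0 i s k) else 0)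
        = ∑ k ∈ univ.erase i, (if (∀ j, j ≠ k → blk j (Function.update x0 i t j) = b' j)
          then coef (w k) (m k) (blk k) (b' k) (Function.update x0 i t k) else 0) := by
      refine Finset.sum_congr rfl fun k hk => ?_
      have hki : k ≠ i := ne_of_mem_erase hk
      have hc : (∀ j, j ≠ k → blk j (Function.update x0 i s j) = b' j)
          ↔ (∀ j, j ≠ k → blk j (Function.update x0 i t j) = b' j) :=
        forall_congr' fun j => forall_congr' fun _ => by rw [hpi j]
      rw [Function.update_of_ne hki, Function.update_of_ne hki]
      exact if_congr hc rfl rfl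
    rw [hrest] at key
    linarith
  · intro h
    rw [crit_iff]
    intro b' x y hxy
    rw [coef_pi, coef_pi]
    refine Finset.sum_congr rfl fun i _ => ?_
    have hj : ∀ j, blk j (x j) = blk j (y j) := fun j => congr_fun hxy j
    have hc : (∀ j, j ≠ i → blk j (x j) = b' j) ↔ (∀ j, j ≠ i → blk j (y j) = b' j) :=
      ⟨fun hh j hji => (hj j).symm.trans (hh j hji), fun hh j hji => (hj j).trans (hh j hji)⟩
    refine if_congr hc ?_ rfl
    exact (crit_iff.1 (h i)) (b' i) (x i) (y i) (hj i)

end Pi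

/-! ## §2  Periodic chains ℤ/N with blocks of L consecutive sites, and the tori (ℤ/N)^d -/

section Cycle

/-- Nearest-neighbour bond weights on the cycle ℤ/N (the simple cycle for N ≥ 3; symmetric by construction).
[cite: Balaban1985BackgroundPropagators, (3.23) p. 394] -/
def cycW (N : ℕ) (x y : Fin N) : ℝ :=
  (if y.val = (x.val + 1) % N then 1 else 0) + (if x.val = (y.val + 1) % N then 1 else 0)

/-- Blocks of L consecutive sites: site x lies in block ⌊x/L⌋. [cite: Balaban1985BackgroundPropagators, (3.18)–(3.19) p. 393] -/
def cycBlk (L : ℕ) {N : ℕ} (x : Fin N) : ℕ := x.val / L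

/-- helper: `cycW` is symmetric. [folklore] -/
private theorem cycW_symm {N : ℕ} (x y : Fin N) : cycW N x y = cycW N y x := by
  unfold cycW; exact add_comm _ _

/-- helper: `cycW` is non-negative. [folklore] -/
private theorem cycW_nonneg {N : ℕ} (x y : Fin N) : 0 ≤ cycW N x y := by
  unfold cycW; exact add_nonneg (by split_ifs <;> norm_num) (by split_ifs <;> norm_num)

/-- L = 1: the criterion holds (any weights). [cite: Balaban1985BackgroundPropagators, (3.163)–(3.165) p. 429] -/
theorem crit_cyc_one {N : ℕ} (w : Fin N → Fin N → ℝ) (m : Fin N → ℝ) : Crit w m (cycBlk (N := N) 1) :=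
  crit_of_injective fun x y h => Fin.ext (by simpa [cycBlk] using h)

/-- One block (N ≤ L, in particular K = 1): all bonds are internal and the criterion holds.
[cite: Balaban1985BackgroundPropagators, (3.163)–(3.165) p. 429] -/
theorem crit_cyc_single {N L : ℕ} (hNL : N ≤ L) : Crit (cycW N) 0 (cycBlk (N := N) L) :=
  crit_of_noCross cycW_symm fun x y hne => (hne (by
    have := x.isLt; have := y.isLt
    show x.val / L = y.val / L
    rw [Nat.div_eq_of_lt (by omega), Nat.div_eq_of_lt (by omega)])).elim

/-- L ≥ 3 and at least two blocks: the criterion FAILS (a block boundary site has a neighbour in the next block,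
an interior site has none). [cite: Balaban1985RegularSpaces, (1.91) p. 91; Balaban1985BackgroundPropagators,
(3.163)–(3.165) p. 429] -/
theorem not_crit_cyc_three {N L K : ℕ} (hN : N = L * K) (hL : 3 ≤ L) (hK : 2 ≤ K) :
    ¬ Crit (cycW N) 0 (cycBlk (N := N) L) := by
  subst hN
  have hLK : 2 * L ≤ L * K := by nlinarith
  have hxN : L - 1 < L * K := by omega
  have h1N : 1 < L * K := by omega
  have hLN : L < L * K := by omega
  intro h
  have key := crit_iff.1 h 1 ⟨L - 1, hxN⟩ ⟨1, h1N⟩ (by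
    show (L - 1) / L = 1 / L
    rw [Nat.div_eq_of_lt (by omega), Nat.div_eq_of_lt (by omega)])
  -- the second site of block 0 has no neighbour in block 1
  have hA : ∑ y ∈ univ with cycBlk L y = 1, cycW (L * K) y ⟨1, h1N⟩ = 0 := by
    refine Finset.sum_eq_zero fun y hy => ?_
    have hy1 : y.val / L = 1 := (mem_filter.1 hy).2
    have hyL : L ≤ y.val := by
      by_contra hlt
      rw [Nat.div_eq_of_lt (by omega)] at hy1
      omega
    have hyN := y.isLt
    have c1 : ¬ ((1 : ℕ) = (y.val + 1) % (L * K)) := by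
      rcases Nat.lt_or_ge (y.val + 1) (L * K) with hlt | hge
      · rw [Nat.mod_eq_of_lt hlt]; omega
      · rw [show y.val + 1 = L * K by omega, Nat.mod_self]; omega
    have c2 : ¬ (y.val = (1 + 1) % (L * K)) := by
      rw [Nat.mod_eq_of_lt (by omega)]; omega
    show (if (1 : ℕ) = (y.val + 1) % (L * K) then (1 : ℝ) else 0)
        + (if y.val = (1 + 1) % (L * K) then (1 : ℝ) else 0) = 0
    rw [if_neg c1, if_neg c2, add_zero]
  -- the last site of block 0 has the neighbour L in block 1
  have hB : (1 : ℝ) ≤ ∑ y ∈ univ with cycBlk L y = 1, cycW (L * K) y ⟨L - 1, hxN⟩ := by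
    have hmem : (⟨L, hLN⟩ : Fin (L * K)) ∈ (univ.filter fun y : Fin (L * K) => cycBlk L y = 1) := by
      rw [mem_filter]
      exact ⟨mem_univ _, by show L / L = 1; exact Nat.div_self (by omega)⟩
    refine le_trans ?_ (Finset.single_le_sum (f := fun y => cycW (L * K) y ⟨L - 1, hxN⟩)
      (fun y _ => cycW_nonneg y _) hmem)
    have c3 : (L : ℕ) = (L - 1 + 1) % (L * K) := by
      rw [show L - 1 + 1 = L by omega, Nat.mod_eq_of_lt hLN]
    show (1 : ℝ) ≤ (if (L - 1 : ℕ) = (L + 1) % (L * K) then (1 : ℝ) else 0)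
        + (if (L : ℕ) = (L - 1 + 1) % (L * K) then (1 : ℝ) else 0)
    rw [if_pos c3]
    have : (0 : ℝ) ≤ (if (L - 1 : ℕ) = (L + 1) % (L * K) then (1 : ℝ) else 0) := by
      split_ifs <;> norm_num
    linarith
  rw [coef_of_ne (show ¬ (cycBlk L (⟨L - 1, hxN⟩ : Fin (L * K)) = 1) by
      show ¬ ((L - 1) / L = 1); rw [Nat.div_eq_of_lt (by omega)]; omega),
    coef_of_ne (show ¬ (cycBlk L (⟨1, h1N⟩ : Fin (L * K)) = 1) by
      show ¬ (1 / L = 1); rw [Nat.div_eq_of_lt (by omega)]; omega), hA, neg_zero] at key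
  linarith

/-- L = 2 and at least three blocks: the criterion FAILS. [cite: Balaban1985RegularSpaces, (1.91) p. 91;
Balaban1985BackgroundPropagators, (3.163)–(3.165) p. 429] -/
theorem not_crit_cyc_two {N K : ℕ} (hN : N = 2 * K) (hK : 3 ≤ K) :
    ¬ Crit (cycW N) 0 (cycBlk (N := N) 2) := by
  subst hN
  have h0 : 0 < 2 * K := by omega
  have h1 : 1 < 2 * K := by omega
  have h2 : 2 < 2 * K := by omega
  intro h
  have key := crit_iff.1 h 1 ⟨1, h1⟩ ⟨0, h0⟩ (by show 1 / 2 = 0 / 2; norm_num)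
  -- site 0 has no neighbour in block 1 = {2, 3} (its neighbours are 1 and 2K − 1 ≥ 5)
  have hA : ∑ y ∈ univ with cycBlk 2 y = 1, cycW (2 * K) y ⟨0, h0⟩ = 0 := by
    refine Finset.sum_eq_zero fun y hy => ?_
    have hy1 : y.val / 2 = 1 := (mem_filter.1 hy).2
    have c1 : ¬ ((0 : ℕ) = (y.val + 1) % (2 * K)) := by
      rw [Nat.mod_eq_of_lt (by omega)]; omega
    have c2 : ¬ (y.val = (0 + 1) % (2 * K)) := by
      rw [Nat.mod_eq_of_lt (by omega)]; omega
    show (if (0 : ℕ) = (y.val + 1) % (2 * K) then (1 : ℝ) else 0)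
        + (if y.val = (0 + 1) % (2 * K) then (1 : ℝ) else 0) = 0
    rw [if_neg c1, if_neg c2, add_zero]
  -- site 1 has the neighbour 2 in block 1
  have hB : (1 : ℝ) ≤ ∑ y ∈ univ with cycBlk 2 y = 1, cycW (2 * K) y ⟨1, h1⟩ := by
    have hmem : (⟨2, h2⟩ : Fin (2 * K)) ∈ (univ.filter fun y : Fin (2 * K) => cycBlk 2 y = 1) := by
      rw [mem_filter]
      exact ⟨mem_univ _, by show 2 / 2 = 1; norm_num⟩
    refine le_trans ?_ (Finset.single_le_sum (f := fun y => cycW (2 * K) y ⟨1, h1⟩)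
      (fun y _ => cycW_nonneg y _) hmem)
    have c3 : (2 : ℕ) = (1 + 1) % (2 * K) := by rw [Nat.mod_eq_of_lt (by omega)]
    show (1 : ℝ) ≤ (if (1 : ℕ) = (2 + 1) % (2 * K) then (1 : ℝ) else 0)
        + (if (2 : ℕ) = (1 + 1) % (2 * K) then (1 : ℝ) else 0)
    rw [if_pos c3]
    have : (0 : ℝ) ≤ (if (1 : ℕ) = (2 + 1) % (2 * K) then (1 : ℝ) else 0) := by
      split_ifs <;> norm_num
    linarith
  rw [coef_of_ne (show ¬ (cycBlk 2 (⟨1, h1⟩ : Fin (2 * K)) = 1) by show ¬ (1 / 2 = 1); norm_num),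
    coef_of_ne (show ¬ (cycBlk 2 (⟨0, h0⟩ : Fin (2 * K)) = 1) by show ¬ (0 / 2 = 1); norm_num),
    hA, neg_zero] at key
  linarith

/-- The 4-cycle with two blocks of two sites, (L, K) = (2, 2): the criterion HOLDS although every site has a
bond into the other block. [cite: Balaban1985RegularSpaces, (1.91) p. 91; Balaban1985BackgroundPropagators,
(3.163)–(3.165) p. 429] -/
theorem crit_cyc_two_two {N : ℕ} (hN : N = 4) : Crit (cycW N) 0 (cycBlk (N := N) 2) := by
  subst hN
  refine crit_iff.2 fun b' x y hxy => ?_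
  rcases Nat.lt_or_ge b' 2 with hb | hb
  · interval_cases b' <;>
      (fin_cases x <;> fin_cases y <;>
        (first
          | (exfalso; revert hxy; norm_num [cycBlk]; done)
          | norm_num [coef, cycW, cycBlk, Finset.sum_filter, Fin.sum_univ_four]))
  · have hne : ∀ z : Fin 4, cycBlk 2 z ≠ b' := by
      intro z; have := z.isLt; show z.val / 2 ≠ b'; omega
    rw [coef_eq_zero_of_forall_ne hne, coef_eq_zero_of_forall_ne hne]

/-- **Classification on the periodic chain** ℤ/(LK) with K blocks of L consecutive sites and the
nearest-neighbour Laplacian: Q′ΔN(Q′) = 0 ⟺ L = 1 ∨ K = 1 ∨ (L, K) = (2, 2).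
[cite: Balaban1985RegularSpaces, (1.91) p. 91; Balaban1985BackgroundPropagators, (3.163)–(3.165) p. 429] -/
theorem crit_cyc_iff {N L K : ℕ} (hN : N = L * K) (hL : 1 ≤ L) (hK : 1 ≤ K) :
    Crit (cycW N) 0 (cycBlk (N := N) L) ↔ (L = 1 ∨ K = 1 ∨ (L = 2 ∧ K = 2)) := by
  constructor
  · intro h
    by_contra hne
    rcases Nat.lt_or_ge L 3 with hL3 | hL3
    · obtain rfl : L = 2 := by omega
      exact not_crit_cyc_two hN (by omega) h
    · exact not_crit_cyc_three hN hL3 (by omega) h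
  · rintro (hL1 | hK1 | ⟨hL2, hK2⟩)
    · subst hL1; exact crit_cyc_one _ _
    · subst hK1; exact crit_cyc_single (by rw [hN, Nat.mul_one])
    · subst hL2; subst hK2; exact crit_cyc_two_two (by rw [hN])

/-- **Classification on the torus** (ℤ/(LK))^d, d ≥ 1, cubic blocks of side L, nearest-neighbour Laplacian
(the scalar 𝔤 = ℝ, flat-background case of [B8]'s Δ^η_{U₀} restricted to nothing: periodic, no ∂Ω₀-bonds):
Q′ΔN(Q′) = 0 ⟺ L = 1 ∨ K = 1 ∨ (L, K) = (2, 2).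
[cite: Balaban1985RegularSpaces, (1.91) p. 91; Balaban1985BackgroundPropagators, (3.163)–(3.165) p. 429] -/
theorem crit_torus_iff {ι : Type*} [Fintype ι] [DecidableEq ι] [Nonempty ι] {N L K : ℕ} (hN : N = L * K)
    (hL : 1 ≤ L) (hK : 1 ≤ K) :
    Crit (piW fun _ : ι => cycW N) 0 (piBlk fun _ : ι => cycBlk (N := N) L)
      ↔ (L = 1 ∨ K = 1 ∨ (L = 2 ∧ K = 2)) := by
  haveI : Nonempty (Fin N) := ⟨⟨0, by rw [hN]; exact Nat.mul_pos hL hK⟩⟩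
  have hm : (0 : (ι → Fin N) → ℝ) = piM (fun _ : ι => (0 : Fin N → ℝ)) := by
    funext x; simp [piM]
  rw [hm, crit_pi_iff]
  exact (forall_const ι).trans (crit_cyc_iff hN hL hK)

/-- The six-site instance (L, K) = (3, 2) of `B8Eq194FirstTerm.Witness6` (there by the explicit λ = δ₀ − δ₁).
[cite: Balaban1985RegularSpaces, (1.91) p. 91] -/
theorem not_crit_six : ¬ Crit (cycW 6) 0 (cycBlk (N := 6) 3) :=
  not_crit_cyc_three (L := 3) (K := 2) (by norm_num) (by norm_num) (by norm_num)

end Cycle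

end Literature.MathematicalPhysics.QuantumFieldTheory.Balaban1983to89.B8Eq194CriterionTorus
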